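import Literature.MathematicalPhysics.QuantumFieldTheory.Balaban1983to89.T4MatchingClosure
import Literature.MathematicalPhysics.QuantumFieldTheory.Balaban1983to89.T4PersistentHistoryCount
import Summits.QuantumFields.YangMills.Theorems.BalabanUVNodesN19TameConditionedHellingerLetterAlongK

/-!
# BalabanUVNodes ∕ node N20 (NE7b) — THE ONE-RUN WILD-MASS LETTER (V‑a) OF THE HELLINGER ROAD FROM THE TREE'S PERSISTENT-HISTORY
# COUNT: exponent 2 under the logarithmic cut, BY NAME, and the LOCATED map «over-age lemma ↔ tree»

Cell `pub-ymgap` (HUMAN RULING D-0062 Track A ∕ director-ym R399 (3a) second-wave width seats), WIDTH SEAT `pub-ymgap-dag-n20-w4`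
(node n20 = NE7b, persistent-activity relative weight bound), generation g3, CLAIM-1 ∕ INTENT-1 (bus I.34875 ∕ S.21435, 2026-08-28T09:10Z).
Route `Summits/QuantumFields/YangMills/Theses/BalabanUVNodes.lean`, key item K3⁷ `SpineGivenEndpointR13SepCoPH` (stmt-QuantumFields-20544; skeleton
of record v5 941dddb108cbaacf, stub 2 `stub_expansion13H`, N20 face `KeyedRelWeight cr`); filed `--kind proof --supports … --as helper`.  COUNT-NEUTRAL.
THEOREMS ONLY (0 `def`, 0 `instance`, 0 `notation`, 0 `sorry`).  ADDITIVE — imports `Literature.…Balaban1983to89.T4MatchingClosure` (⇒ `T4GoodClassBudget`,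
`T4HistoryPeeling`, `T4WeightBudget`), `…T4PersistentHistoryCount`, and dag-n19-w4 g6's `…N19TameConditionedHellingerLetterAlongK` (p618979) BY NAME;
modifies nothing, re-declares nothing.

WHY (trigger (t2) of `HOME/HANDOFF-dag-n20-w4.md`).  Idea-3 g13's crux memo `Cruxes/SpineGivenEndpointR13SepCoPH/OVERAGE-RATE-READING-idea3-g13.md`
(2026-08-28 08:30Z) derives ON PAPER, from [Balaban1989LargeFieldII] (1.79)–(1.85), the one-run large-deviation bound behind the hellinger road's
letter (V‑a) («each run's OWN over-aged mass `p_{K,t}(W_{K,t}) ≤ w_K`, `Σ_K √w_K < ∞`») and window-key-core's (AC) (`Σ_K w_K < ∞`), and says (§4):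
«A kernel version would be a finite combinatorial lemma over an abstract "refresh process" (epoch lengths `≤ R̄+c₀`, refresh price `≥ p`, positions
`L^{4m}`) — … not written»; CRIT-1 g6's re-price (`CRIT-1-REPRICE-hellinger-free-energy-road-ed5-overage.md`, 08:54Z) confirms the reading and books it
«derived-not-quoted … not kernel-checked».  THE KERNEL EXISTS IN THE TREE (cell `pub-balaban`, node U5c ∕ NE7b, typed 2026-08-18 → 20) — LOCATED MAP,
memo §3 ↔ tree, everything BY NAME:
* §3(b) «pendency beyond the budget needs a fresh large field, every time; budget `K_j(Z) ≤ R_j + c₀`» = the EVENT COUNT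
  `T4WeightBudget.card_Icc_le_of_windows` (uniform window `N`) and its variable-window form `T4PersistentHistoryCount.SpanLE` ∕ `spanLE_of_covers` ∕
  `covers_of_admissible` (windows attached to the events: renewal «K = R_{j+1}» p. 386, epoch «K ≤ n₀ − j + R_j» p. 385, merger «K ≤ K₂ + n₁ + R_{j+1}»
  p. 387 — mergers ARE events there, which is the memo's case 2 of (Q6));
* §3(c) «net price per refresh `p₀^net(j) = p₀(g_j) − D_j − O(1) ≥ ½ p₀(g_j)`, the drawdown (1.81)» = `T4PersistentHistoryCount.credit_dominates_window`
  (γ-clause on the INFRARED coupling alone ⇒ `κ₁·W s + E ≤ c·p₀(g_s)` at EVERY scale, K-UNIFORMLY along the typed B14 (2.5)∕(2.7) flow),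
  `credit_dominates_window_poly` ∕ `windowCost_le` ∕ `windowCostDecay_le` (the two R-polynomial sums of (1.81)), `birthCredit_dominates` (the
  size-carrying costs, fatness class by fatness class) — i.e. the memo's «`c` is K-INDEPENDENT … with orders of magnitude to spare exactly where print's
  own (1.82) ∕ p. 386 L3 hold» with the `o(1)` made an explicit infrared threshold (`exists_threshold{,_poly}`);
* §3(d) «FROM PRICE TO RATE, time-pattern entropy WITHOUT a `log 2` per step» (the `y·z` split, `Σ_{patterns} Π z ≤ Π_j (1 + z_j) ≤ exp Σ z_j`) =
  `T4PersistentHistoryCount.pairedRecordSum_le` ∕ `pairedRecordSum_births_le` (records counted EXACTLY as subsets, Mathlib `Finset.prod_one_add`, no window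
  cap, no event-number floor) ∕ `prod_one_add_le_exp_mul` ∕ `slotPrice_le` (per-step survival rate `σ := e^{η̄ − κ₁}`);
* §3(e) «positions `vol·L^{4m}`, sum over birth depths, geometric tail converging iff `c > 4 log L`» = `T4PersistentHistoryCount.card_torusCells` ∕
  `oldSlotBudget_le` ∕ `slotDom_of_records` (two-rate budget `S K = ρ̄e^{−κ₁}·V·(Λσ)^{K − j⋆(K) + 1}∕(1 − Λσ)`, `Λ = L⁴`), `twoRate_lt_one_of_margin` ∕
  `pow_four_mul_exp_lt_one_iff` (= `0 < T4WeightBudget.survivalRate`), `T4WeightBudget.sum_range_pow_sub_le` ∕ `twoRate_majorant_le`; the LOG WINDOW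
  «`j⋆(K) = bud + κ₁ log K` … `wild_K ≤ C_w·K^{−κ₁(c − 4 log L)}`» = `T4GoodClassBudget.jlogOf` ∕ `rpow_log_swap` ∕ `summable_weightMajorant_log`; and
  EXPONENT 1 (window-key-core (AC), memo «`Σ_K wild_K < ∞ ⇐ κ₁ := 2∕(c − 4 log L)`») = `T4MatchingClosure.summable_twoRateBudget_log` ∕
  `relWeightBound_of_slotDom_twoRate_log` under `1 < C·(−log r)`;
* the memo's §4 caveat «§3 is a COROLLARY of his factors read as upper bounds on relative class weights — the modelling both cards declare ((KR))» = the
  HYPOTHESIS SHAPE `T4HistoryPeeling.SlotDom` (the single-slot, context-uniform insertion price: «the unprinted heart of NE7b»), NOT discharged anywhere.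
DICTIONARY memo ↔ tree: memo's window constant `κ₁` = tree's log-cut constant `C` (`jlogOf C K = K − ⌈C·log(K+1)⌉`); memo's net refresh rate per step
`c` = tree's `κ₁ − η̄` (credit per window step minus residual entropy per step); memo's `4 log L` = `log Λ`, `Λ = L⁴`; memo's `wild_K` = the RELATIVE weight
`(Σ_{Bad K t} A)∕(Σ_{T K} A)` of `T4WeightBudget.RelWeightBound` ∕ the wild mass `(Σ_{W K t} A)∕(Σ_{T K} A)` of `affinityDefectLetter_of_tameTilts`.
NOT IN THE TREE BEFORE THIS FILE: EXPONENT 2 — the hellinger road needs `Σ_K √wild_K < ∞` (memo: «iff `κ₁(c − 4 log L) > 2`»), and the by-name bridge from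
`RelWeightBound`'s PRODUCT form to the road's DIVISION-form binders.  THIS FILE:
* §1 `div_le_of_le_mul_of_nonneg`, `relWeight_div_le_left` ∕ `_right` — `RelWeightBound l₀ T A B Bad W` ⇒ `(Σ_{Bad K t} A)∕(Σ_{T K} A) ≤ W K` (both runs).
* §2 ★ `summable_sqrt_weightMajorant_log` — `2 < C·(−log r)` ⇒ `Summable (K ↦ √(V·r^{K − jlogOf C K}))` (= `T4GoodClassBudget.summable_weightMajorant_log` AT
  `√r`; `√(r^n) = (√r)^n`, `log √r = ½ log r`); ★ `summable_sqrt_twoRateBudget_log` (the budget of `relWeightBound_of_slotDom_twoRate_log`, √-summable).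
* §3 ★★ `wildMassLetter_of_relWeightBound` — ANY `RelWeightBound` with √-summable weights gives the literal `(wm, hwm, hwildA, hwildB, hws)` binder block of
  dag-n19-w4's `affinityDefectLetter_of_tameTilts` ∕ `hellingerRate_of_tameTilts` (with `W := Bad`); ★★ `wildMassLetter_of_slotDom_twoRate_log` — EXACTLY the
  hypotheses of `T4MatchingClosure.relWeightBound_of_slotDom_twoRate_log` with `1 < C·(−log r)` strengthened to `2 < C·(−log r)` ⇒ the block
  (`wm K := 1 − e^{−S K}`, `√(1 − e^{−S}) ≤ √S`).
* §4 ★★★ `hellingerRate_of_slotDom_twoRate_log` — dag-n19-w4's `hellingerRate_of_tameTilts` with its wild-mass block DISCHARGED by two `SlotDom`s at the log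
  two-rate budget: `∃ ρ` summable, `√(1 − Σ_{T K}√(p_{A,K,t} p_{B,K,t})) ≤ ρ_K` from (single-slot prices for both runs) + (tame tilts, radii, regime).
* §5 ★★ `wildMassLetter_of_records_log` — END TO END, ONE LEVEL LOWER: `T4PersistentHistoryCount.slotDom_of_records` (per-record PRICES + birth cells +
  switch-off data, for each run) at the log cut `j⋆ := jlogOf C` with `2 < C·(−log(Λ·e^{η̄ − κ₁}))` ⇒ the block.  §6 `neg_log_twoRate_eq` ∕
  `two_lt_mul_neg_log_twoRate_iff` ∕ `margin_of_two_lt` — the rate letter read: `2 < C·(−log(L⁴·e^{η̄−κ₁})) ↔ 2 < C·(κ₁ − η̄ − 4·log L)` = the memo's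
  «`κ₁(c − 4 log L) > 2`», and it implies the exponent-1 margin `4·log L + η̄ < κ₁`.  §7 sanity (`2 < 2·(−log ¼)`; the junk-inhabited `Bad := ∅` case).
CREDIT.  The over-age READING and its page locators: idea-3 g13 (memo), CRIT-1 g5∕g6 (riders R1∕R2, re-price); the kernel of §3(b)–(e): cell `pub-balaban`
(`T4WeightBudget` v1.1, `T4HistoryPeeling`, `T4PersistentHistoryCount` v1.4, `T4GoodClassBudget` v1.1 §3b, `T4MatchingClosure` §LogCut); the consumer
shapes: dag-n19-w4 g6 (p618660 ∕ p618979), idea-3 g10–g13 (`hellingerRate_of_tameTilts`, kernel ed.4 §13, `Cruxes/` — not importable).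

HONEST FRAMING.  [folklore] real analysis composing EXISTING tree kernel BY NAME on hypothesis SHAPES.  `SlotDom` ∕ `RelWeightBound` ∕ the per-record price
`hdom` of `slotDom_of_records` — the single-slot CONTEXT-UNIFORM insertion price, i.e. the cards' (KR) + «printed factors as upper bounds on relative keyed
class weights» — are HYPOTHESES produced by nobody (and `RelWeightBound` alone is junk-inhabited by `Bad := ∅, W := 0`: content only jointly with the
core-edge face on `T K ∖ Bad K t`, START-LIST §n20 FACTS); (V‑b) = (YG) and (R′) are two-run and UNPRINTED for d = 4; the memo's (V‑a) is a paper
reading, one-run; NO estimate of Bałaban's programme is proved; nothing of Bałaban's asserted or instantiated (no `Provisos₁₃SepCoPH` tuple — K0⁷ OPEN);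
NE7b NOT PRINTED for d = 4 ∕ NOT proved; N19 ∕ N20 ∕ N21 NOT discharged; K3⁷ OPEN, v5 STANDS, not claimed; counts UNMOVED (typed 28∕28 · discharged 5∕27,
A 5∕28); no summit statement is proved by this seat.  One finite four-torus programme at fixed ε — NOT ℝ⁴, NOT infinite volume (there the per-step
comparison is Kakutani-singular, card ed.5 l.14), NOT OS, NOT a mass gap, NOT the Clay problem (R4 closes the conditional finite-𝕋⁴ rung `BalabanLadder.UV`
only).  0 `def`; 0 `sorry`; standard axioms; no cite tags (locators above are the memo's and the imported modules', quoted for context only).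
-/

noncomputable section

namespace Summit.QuantumFields.YangMills.BalabanUVNodes.N20WildMassLetterOfPersistentHistoryCount

open Finset
open Literature.MathematicalPhysics.QuantumFieldTheory.Balaban1983to89
open Literature.MathematicalPhysics.QuantumFieldTheory.Balaban1983to89.T4WeightBudget (RelWeightBound survivalRate)
open Literature.MathematicalPhysics.QuantumFieldTheory.Balaban1983to89.T4HistoryPeeling (SwitchOff SlotDom relWeightBound_of_slotDom)
open Literature.MathematicalPhysics.QuantumFieldTheory.Balaban1983to89.T4GoodClassBudget (jlogOf jlogOf_le summable_weightMajorant_log)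
open Literature.MathematicalPhysics.QuantumFieldTheory.Balaban1983to89.T4MatchingClosure
  (summable_twoRateBudget_log relWeightBound_of_slotDom_twoRate_log)
open Literature.MathematicalPhysics.QuantumFieldTheory.Balaban1983to89.T4PersistentHistoryCount (records slotDom_of_records)
open Summit.QuantumFields.YangMills.BalabanUVNodes.N19TameConditionedHellingerLetterAlongK (hellingerRate_of_tameTilts)

/-! ## §1 Product form ⇒ division form: `RelWeightBound` supplies the road's wild-mass binders [folklore] -/

section Division

variable {ι : Type*} {l₀ : ℝ} {T : ℕ → Finset ι} {A B : ℕ → ℝ → ι → ℝ} {Bad : ℕ → ℝ → Finset ι} {W : ℕ → ℝ}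

/-- `x ≤ w·y` with `y, w ≥ 0` gives `x∕y ≤ w` (also when `y = 0`, where `x∕0 = 0`). [folklore] -/
theorem div_le_of_le_mul_of_nonneg {x y w : ℝ} (hy : 0 ≤ y) (hw : 0 ≤ w) (h : x ≤ w * y) : x / y ≤ w := by
  rcases hy.eq_or_lt with hy0 | hy'
  · rw [← hy0, div_zero]; exact hw
  · rwa [div_le_iff₀ hy']

/-- Run A: a `RelWeightBound` gives the DIVISION-form wild-mass bound `(Σ_{Bad K t} A)∕(Σ_{T K} A) ≤ W K` on `|t| ≤ l₀` (non-negative weights) —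
the `hwildA` binder of dag-n19-w4's `affinityDefectLetter_of_tameTilts` with `W := Bad`, `wm := W`. [folklore] -/
theorem relWeight_div_le_left (hW : RelWeightBound l₀ T A B Bad W) (hA : ∀ K t, |t| ≤ l₀ → ∀ τ ∈ T K, 0 ≤ A K t τ)
    (K : ℕ) (t : ℝ) (ht : |t| ≤ l₀) : (∑ τ ∈ Bad K t, A K t τ) / (∑ σ ∈ T K, A K t σ) ≤ W K :=
  div_le_of_le_mul_of_nonneg (sum_nonneg (hA K t ht)) (hW.nonneg K) (hW.bad_left K t ht)

/-- Run B: the same for the second run (`hwildB`). [folklore] -/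
theorem relWeight_div_le_right (hW : RelWeightBound l₀ T A B Bad W) (hB : ∀ K t, |t| ≤ l₀ → ∀ τ ∈ T K, 0 ≤ B K t τ)
    (K : ℕ) (t : ℝ) (ht : |t| ≤ l₀) : (∑ τ ∈ Bad K t, B K t τ) / (∑ σ ∈ T K, B K t σ) ≤ W K :=
  div_le_of_le_mul_of_nonneg (sum_nonneg (hB K t ht)) (hW.nonneg K) (hW.bad_right K t ht)

end Division

/-! ## §2 EXPONENT 2: the two-rate weight majorant under the log cut is √-SUMMABLE once `2 < C·(−log r)` [folklore] -/

section SqrtMajorant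

/-- `log √r = ½·log r` for `r > 0`. [folklore] -/
theorem log_sqrt_eq_half_log {r : ℝ} (hr : 0 < r) : Real.log (Real.sqrt r) = Real.log r / 2 := by
  rw [Real.sqrt_eq_rpow, Real.log_rpow hr]; ring

/-- **★ THE WEIGHT MAJORANT UNDER THE LOG CUT IS √-SUMMABLE AT EXPONENT 2.**  For `0 < r < 1`, `V ≥ 0` and `2 < C·(−log r)`:
`Σ_K √(V·r^{K − jlog_C(K)}) < ∞` — `T4GoodClassBudget.summable_weightMajorant_log` (exponent 1, `1 < C·(−log r)`) applied AT `√r`, since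
`√(V·r^{n}) = √V·(√r)^{n}` and `C·(−log √r) = ½·C·(−log r)`.  READING (memo §3(e) verdict): `wild_K ≲ C_w·K^{−κ₁(c − 4 log L)}` is √-summable iff
`κ₁(c − 4 log L) > 2`; here `C` = the memo's `κ₁`, `−log r` = the memo's `c − 4 log L`. [folklore] -/
theorem summable_sqrt_weightMajorant_log {r V C : ℝ} (h0 : 0 < r) (h1 : r < 1) (hV : 0 ≤ V)
    (hC : 2 < C * (-Real.log r)) :
    Summable (fun K => Real.sqrt (V * r ^ (K - jlogOf C K))) := by
  have hs0 : 0 < Real.sqrt r := Real.sqrt_pos.2 h0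
  have hs1 : Real.sqrt r < 1 := by
    rw [Real.sqrt_lt' one_pos, one_pow]; exact h1
  have hC' : 1 < C * (-Real.log (Real.sqrt r)) := by
    rw [log_sqrt_eq_half_log h0]; linarith
  have h := summable_weightMajorant_log (V := Real.sqrt V) (C := C) hs0 hs1 (Real.sqrt_nonneg V) hC'
  refine h.congr fun K => ?_
  -- `√(V·r^n) = √V·(√r)^n` (folklore, inlined)
  have hpow : Real.sqrt (r ^ (K - jlogOf C K)) = Real.sqrt r ^ (K - jlogOf C K) := by
    have e : (Real.sqrt r ^ (K - jlogOf C K)) ^ 2 = r ^ (K - jlogOf C K) := by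
      rw [← pow_mul, mul_comm, pow_mul, Real.sq_sqrt h0.le]
    rw [← e, Real.sqrt_sq (pow_nonneg (Real.sqrt_nonneg r) _)]
  rw [Real.sqrt_mul hV, hpow]

/-- **★ THE LOG TWO-RATE BUDGET IS √-SUMMABLE AT EXPONENT 2**: the slot budget `S K = Cs·V·r^{K − jlog_C(K) + 1}∕(1 − r)` of
`T4MatchingClosure.relWeightBound_of_slotDom_twoRate_log` satisfies `Σ_K √(S K) < ∞` once `2 < C·(−log r)` (`Cs, V ≥ 0`, `0 < r < 1`). [folklore] -/
theorem summable_sqrt_twoRateBudget_log {Cs V r C : ℝ} (hCs : 0 ≤ Cs) (hV : 0 ≤ V) (h0 : 0 < r) (h1 : r < 1)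
    (hC : 2 < C * (-Real.log r)) :
    Summable fun K => Real.sqrt (Cs * V * (r ^ (K - jlogOf C K + 1) / (1 - r))) := by
  have h := summable_sqrt_weightMajorant_log (V := Cs * V * r / (1 - r)) (C := C) h0 h1
    (div_nonneg (mul_nonneg (mul_nonneg hCs hV) h0.le) (by linarith)) hC
  refine h.congr fun K => ?_
  congr 1
  rw [pow_succ]; ring

end SqrtMajorant

/-! ## §3 The wild-mass binder block of the hellinger road from a `RelWeightBound` ∕ from two single-slot dominations [folklore] -/

section Letter

variable {ι : Type*} {l₀ : ℝ} {T : ℕ → Finset ι} {A B : ℕ → ℝ → ι → ℝ} {Bad : ℕ → ℝ → Finset ι}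

/-- **★★ THE WILD-MASS LETTER FROM A `RelWeightBound` WITH √-SUMMABLE WEIGHTS.**  A `RelWeightBound l₀ T A B Bad W` (the cell's NE7b output shape: both
runs' bad classes have relative weight `≤ W K`, `0 ≤ W K < 1`, `Σ W < ∞`) whose weights are moreover √-SUMMABLE (`Σ_K √(W K) < ∞`) gives, for
non-negative term weights, the LITERAL binder block `(wm, hwm, hwildA, hwildB, hws)` of dag-n19-w4's `affinityDefectLetter_of_tameTilts` ∕
`hellingerRate_of_tameTilts` with wild sets `W K t := Bad K t` and `wm := W`.  HONEST: `RelWeightBound` is a HYPOTHESIS SHAPE produced by nobody.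
[folklore] -/
theorem wildMassLetter_of_relWeightBound {W : ℕ → ℝ} (hW : RelWeightBound l₀ T A B Bad W)
    (hA : ∀ K t, |t| ≤ l₀ → ∀ τ ∈ T K, 0 ≤ A K t τ) (hB : ∀ K t, |t| ≤ l₀ → ∀ τ ∈ T K, 0 ≤ B K t τ)
    (hsq : Summable fun K => Real.sqrt (W K)) :
    ∃ wm : ℕ → ℝ, (∀ K, 0 ≤ wm K) ∧
      (∀ K t, |t| ≤ l₀ → (∑ τ ∈ Bad K t, A K t τ) / (∑ σ ∈ T K, A K t σ) ≤ wm K) ∧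
      (∀ K t, |t| ≤ l₀ → (∑ τ ∈ Bad K t, B K t τ) / (∑ σ ∈ T K, B K t σ) ≤ wm K) ∧
      Summable (fun K => Real.sqrt (wm K)) :=
  ⟨W, hW.nonneg, fun K t ht => relWeight_div_le_left hW hA K t ht,
    fun K t ht => relWeight_div_le_right hW hB K t ht, hsq⟩

variable [DecidableEq ι]

/-- **★★ THE WILD-MASS LETTER (V‑a) FROM TWO SINGLE-SLOT DOMINATIONS AT THE LOG TWO-RATE BUDGET, EXPONENT 2.**  EXACTLY the hypotheses of
`T4MatchingClosure.relWeightBound_of_slotDom_twoRate_log` — `SlotDom` for run A and for run B (the single-slot context-uniform insertion price of every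
old pending structure, per run) with the common slot budget `S K = Cs·V·r^{K − jlog_C(K) + 1}∕(1 − r)`, `0 < r < 1`, `Cs, V ≥ 0`, non-negative weights —
with the rate condition strengthened from `1 < C·(−log r)` to `2 < C·(−log r)`, give the wild-mass block with √-SUMMABLE bounds:
`wm K := 1 − exp(−S K)` (`≤ S K`, and `Σ √(S K) < ∞` by §2).  READING: `r = Λσ` with `Λ = L⁴` positions per step of age and `σ = e^{η̄ − κ₁}` the
per-step survival rate of `T4PersistentHistoryCount.slotPrice_le`; `C` = the log-window constant.  HONEST: `SlotDom` is a HYPOTHESIS produced by nobody.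
[folklore] -/
theorem wildMassLetter_of_slotDom_twoRate_log {Cs V r C : ℝ} (hCs : 0 ≤ Cs) (hV : 0 ≤ V) (h0 : 0 < r) (h1 : r < 1)
    (hC : 2 < C * (-Real.log r))
    (hA : ∀ K t, |t| ≤ l₀ → ∀ τ ∈ T K, 0 ≤ A K t τ) (hB : ∀ K t, |t| ≤ l₀ → ∀ τ ∈ T K, 0 ≤ B K t τ)
    (hDA : SlotDom l₀ T A Bad fun K => Cs * V * (r ^ (K - jlogOf C K + 1) / (1 - r)))
    (hDB : SlotDom l₀ T B Bad fun K => Cs * V * (r ^ (K - jlogOf C K + 1) / (1 - r))) :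
    ∃ wm : ℕ → ℝ, (∀ K, 0 ≤ wm K) ∧
      (∀ K t, |t| ≤ l₀ → (∑ τ ∈ Bad K t, A K t τ) / (∑ σ ∈ T K, A K t σ) ≤ wm K) ∧
      (∀ K t, |t| ≤ l₀ → (∑ τ ∈ Bad K t, B K t τ) / (∑ σ ∈ T K, B K t σ) ≤ wm K) ∧
      Summable (fun K => Real.sqrt (wm K)) := by
  have hC1 : 1 < C * (-Real.log r) := by linarith
  have hRW := relWeightBound_of_slotDom_twoRate_log hCs hV h0 h1 hC1 hA hB hDA hDB
  refine wildMassLetter_of_relWeightBound hRW hA hB ?_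
  -- `√(1 − e^{−S}) ≤ √S` from `1 − S ≤ e^{−S}` (folklore, inlined), and `Σ √(S K) < ∞` by §2
  refine Summable.of_nonneg_of_le (fun K => Real.sqrt_nonneg _) (fun K => Real.sqrt_le_sqrt ?_)
    (summable_sqrt_twoRateBudget_log hCs hV h0 h1 hC)
  have := Real.add_one_le_exp (-(Cs * V * (r ^ (K - jlogOf C K + 1) / (1 - r))))
  linarith

end Letter

/-! ## §4 Composition BY NAME with dag-n19-w4's K-summation: the summable Hellinger rate from slot prices + tame tilts [folklore] -/

section Composition

variable {ι : Type*} [DecidableEq ι] {l₀ : ℝ}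

/-- **★★★ THE SUMMABLE HELLINGER RATE WITH THE WILD-MASS LETTER DISCHARGED DOWN TO SINGLE-SLOT PRICES** — dag-n19-w4 g6's
`hellingerRate_of_tameTilts` (p618979; = idea-3's `hellingerRate_of_tameTilts`, kernel ed.4 §13, in the lane's spelled-out affinity) with its binder block
`(wm, hwm, hwildA, hwildB, hws)` SUPPLIED by `wildMassLetter_of_slotDom_twoRate_log`: single-slot dominations of both runs at the log two-rate budget
with `2 < C·(−log r)`, wild sets `W K t := Bad K t ⊆ T K`, POSITIVE class weights on `|t| ≤ l₀`, tilt radii `rad K > 0` with `Σ 1∕rad K < ∞` ((V‑b)),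
ONE tame tilt bound `𝔅`, the tame regime from `K₀` on ⟹ `∃ ρ ≥ 0` summable with `√(1 − Σ_{T K} √(p_{A,K,t}·p_{B,K,t})) ≤ ρ_K` for all `K`, `|t| ≤ l₀`.
HONEST: every letter (the two `SlotDom`s = (KR)+(V‑a)'s modelling, the tame tilts = (KR)+(V‑b) on tame components, the radii, `𝔅`, the regime) is a
HYPOTHESIS produced by nobody; (V‑b) = (YG) is two-run and UNPRINTED for d = 4. [folklore] -/
theorem hellingerRate_of_slotDom_twoRate_log (T : ℕ → Finset ι) (A B : ℕ → ℝ → ι → ℝ)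
    (hA : ∀ K t, |t| ≤ l₀ → ∀ τ ∈ T K, 0 < A K t τ) (hB : ∀ K t, |t| ≤ l₀ → ∀ τ ∈ T K, 0 < B K t τ)
    (Bad : ℕ → ℝ → Finset ι) (hBadT : ∀ K t, Bad K t ⊆ T K)
    {Cs V r C : ℝ} (hCs : 0 ≤ Cs) (hV : 0 ≤ V) (h0 : 0 < r) (h1 : r < 1) (hC : 2 < C * (-Real.log r))
    (hDA : SlotDom l₀ T A Bad fun K => Cs * V * (r ^ (K - jlogOf C K + 1) / (1 - r)))
    (hDB : SlotDom l₀ T B Bad fun K => Cs * V * (r ^ (K - jlogOf C K + 1) / (1 - r)))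
    (rad : ℕ → ℝ) (hrad : ∀ K, 0 < rad K) (hrads : Summable fun K => 1 / rad K)
    {𝔅 : ℝ} (h𝔅 : 0 ≤ 𝔅)
    (htilt : ∀ K t, |t| ≤ l₀ → ∃ φA φB : ℂ → ℂ,
      DifferentiableOn ℂ φA (Metric.closedBall 0 (rad K)) ∧ DifferentiableOn ℂ φB (Metric.closedBall 0 (rad K)) ∧
      (∀ s ∈ Metric.closedBall (0:ℂ) (rad K), Complex.exp (φA s)
        = (∑ τ ∈ T K \ Bad K t, (A K t τ : ℂ) * Complex.exp (s * ((Real.log (B K t τ) - Real.log (A K t τ) : ℝ) : ℂ)))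
            / ∑ τ ∈ T K \ Bad K t, (A K t τ : ℂ)) ∧
      (∀ s ∈ Metric.closedBall (0:ℂ) (rad K), Complex.exp (φB s)
        = (∑ τ ∈ T K \ Bad K t, (B K t τ : ℂ) * Complex.exp (s * ((Real.log (B K t τ) - Real.log (A K t τ) : ℝ) : ℂ)))
            / ∑ τ ∈ T K \ Bad K t, (B K t τ : ℂ)) ∧
      (∀ s ∈ Metric.closedBall (0:ℂ) (rad K), ‖φA s‖ ≤ 𝔅) ∧ (∀ s ∈ Metric.closedBall (0:ℂ) (rad K), ‖φB s‖ ≤ 𝔅))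
    (K₀ : ℕ) (hreg : ∀ K, K₀ ≤ K → ∀ t, |t| ≤ l₀ →
      1 - ∑ τ ∈ T K \ Bad K t,
          Real.sqrt ((A K t τ / ∑ σ ∈ T K \ Bad K t, A K t σ) * (B K t τ / ∑ σ ∈ T K \ Bad K t, B K t σ)) ≤ 1 / 16) :
    ∃ ρ : ℕ → ℝ, Summable ρ ∧ (∀ K, 0 ≤ ρ K) ∧ ∀ K t, |t| ≤ l₀ →
      Real.sqrt (1 - ∑ τ ∈ T K, Real.sqrt ((A K t τ / ∑ σ ∈ T K, A K t σ) * (B K t τ / ∑ σ ∈ T K, B K t σ))) ≤ ρ K := by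
  obtain ⟨wm, hwm, hwA, hwB, hws⟩ := wildMassLetter_of_slotDom_twoRate_log (Bad := Bad) hCs hV h0 h1 hC
    (fun K t ht τ hτ => (hA K t ht τ hτ).le) (fun K t ht τ hτ => (hB K t ht τ hτ).le) hDA hDB
  exact hellingerRate_of_tameTilts T A B hA hB Bad hBadT wm hwm hwA hwB hws rad hrad hrads h𝔅 htilt K₀ hreg

end Composition

/-! ## §5 END TO END, one level lower: from per-record PRICES (the paired record sum) to the wild-mass letter [folklore] -/

section Records

variable {ι γ ε : Type*} [DecidableEq ι] [DecidableEq γ] [DecidableEq ε] {l₀ : ℝ} {T : ℕ → Finset ι}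
  {A B : ℕ → ℝ → ι → ℝ} {Bad : ℕ → ℝ → Finset ι}

/-- **★★ THE WILD-MASS LETTER FROM PER-RECORD PRICES AT THE LOG CUT** — `T4PersistentHistoryCount.slotDom_of_records` for EACH run (birth cells
`Cell K a` with `#Cell K a ≤ V·Λ^a`; events with steps in `(j, K]` and attached windows `W e`; birth residuals `Σ_b ρ b ≤ ρ̄`; event residuals adding up to
`≤ η̄` at each step; per `(K,t)` a switch-off structure whose bad class IS `Bad K t`, slots injectively labelled by (birth step `< jlog_C(K)`, birth cell),
per-record prices `y ≤ ρ b·e^{−κ₁ W b}·Π_{e ∈ Q}(e^{−κ₁ W e}·η e)` and the single-slot ratio bound with ratio `Σ_b Σ_Q y`) — the memo's §3(b)(d)(e) as ONE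
hypothesis list — together with the EXPONENT-2 rate condition `2 < C·(−log(Λ·e^{η̄ − κ₁}))` and `Λ·e^{η̄−κ₁} > 0`, give the wild-mass binder block of
the hellinger road (√-summable bounds on BOTH runs' relative bad-class weights).  HONEST: the per-record price `hdomA`∕`hdomB` (uniform in the context)
is the unprinted single-slot insertion estimate — a HYPOTHESIS produced by nobody; `κ₁ − η̄ > 4 log L` enough for exponent 2 at SOME `C` is the memo's
K-independent `c ≫ 4 log L`, itself typed K-uniformly (as a γ-clause on the infrared coupling) in `T4PersistentHistoryCount.credit_dominates_window{,_poly}`.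
[folklore] -/
theorem wildMassLetter_of_records_log (Cell : ℕ → ℕ → Finset γ) {V Λ : ℝ} (hV : 0 ≤ V) (hΛ : 0 ≤ Λ)
    (hcell : ∀ K a, ((Cell K a).card : ℝ) ≤ V * Λ ^ a) (Wd : ε → ℕ) (step : ε → ℕ)
    (E Bi : ℕ → ℕ → Finset ε) (hE : ∀ K j, ∀ e ∈ E K j, step e ∈ Ioc j K) {κ₁ ρbar ηbar C : ℝ} (hκ : 0 ≤ κ₁)
    (ρ : ε → ℝ) (hρ : ∀ K j, ∀ b ∈ Bi K j, 0 ≤ ρ b) (hρbar : ∀ K j, ∑ b ∈ Bi K j, ρ b ≤ ρbar) (hρbar0 : 0 ≤ ρbar)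
    (η : ε → ℝ) (hη : ∀ K j, ∀ e ∈ E K j, 0 ≤ η e)
    (hηbar : ∀ K j, ∀ t ∈ Ioc j K, ∑ e ∈ E K j with step e = t, η e ≤ ηbar)
    (hr0 : 0 < Λ * Real.exp (ηbar - κ₁)) (hr1 : Λ * Real.exp (ηbar - κ₁) < 1)
    (hC : 2 < C * (-Real.log (Λ * Real.exp (ηbar - κ₁))))
    (hA : ∀ K t, |t| ≤ l₀ → ∀ τ ∈ T K, 0 ≤ A K t τ) (hB : ∀ K t, |t| ≤ l₀ → ∀ τ ∈ T K, 0 ≤ B K t τ)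
    (hdomA : ∀ K t, |t| ≤ l₀ → ∃ (n : ℕ) (Φ : SwitchOff (T K) n) (birth : Fin n → ℕ) (cell : Fin n → γ)
        (y : Fin n → ε → Finset ε → ℝ),
      Bad K t = Φ.bad ∧ (∀ i, birth i < jlogOf C K) ∧ (∀ i, cell i ∈ Cell K (K - birth i)) ∧
      Function.Injective (fun i => (⟨birth i, cell i⟩ : Σ _ : ℕ, γ)) ∧
      (∀ i, ∀ b ∈ Bi K (birth i), ∀ Q ∈ records Wd (birth i) K (E K (birth i)) b, 0 ≤ y i b Q) ∧
      (∀ i, ∀ b ∈ Bi K (birth i), ∀ Q ∈ records Wd (birth i) K (E K (birth i)) b,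
        y i b Q ≤ ρ b * Real.exp (-(κ₁ * Wd b)) * ∏ e ∈ Q, (Real.exp (-(κ₁ * Wd e)) * η e)) ∧
      ∀ i : Fin n, ∀ τ'' ∈ T K, Φ.pend i τ'' = false →
        ∑ τ ∈ T K with (Φ.pend i τ = true ∧ Φ.off i τ = τ''), A K t τ ≤
          (∑ b ∈ Bi K (birth i), ∑ Q ∈ records Wd (birth i) K (E K (birth i)) b, y i b Q) * A K t τ'')
    (hdomB : ∀ K t, |t| ≤ l₀ → ∃ (n : ℕ) (Φ : SwitchOff (T K) n) (birth : Fin n → ℕ) (cell : Fin n → γ)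
        (y : Fin n → ε → Finset ε → ℝ),
      Bad K t = Φ.bad ∧ (∀ i, birth i < jlogOf C K) ∧ (∀ i, cell i ∈ Cell K (K - birth i)) ∧
      Function.Injective (fun i => (⟨birth i, cell i⟩ : Σ _ : ℕ, γ)) ∧
      (∀ i, ∀ b ∈ Bi K (birth i), ∀ Q ∈ records Wd (birth i) K (E K (birth i)) b, 0 ≤ y i b Q) ∧
      (∀ i, ∀ b ∈ Bi K (birth i), ∀ Q ∈ records Wd (birth i) K (E K (birth i)) b,
        y i b Q ≤ ρ b * Real.exp (-(κ₁ * Wd b)) * ∏ e ∈ Q, (Real.exp (-(κ₁ * Wd e)) * η e)) ∧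
      ∀ i : Fin n, ∀ τ'' ∈ T K, Φ.pend i τ'' = false →
        ∑ τ ∈ T K with (Φ.pend i τ = true ∧ Φ.off i τ = τ''), B K t τ ≤
          (∑ b ∈ Bi K (birth i), ∑ Q ∈ records Wd (birth i) K (E K (birth i)) b, y i b Q) * B K t τ'') :
    ∃ wm : ℕ → ℝ, (∀ K, 0 ≤ wm K) ∧
      (∀ K t, |t| ≤ l₀ → (∑ τ ∈ Bad K t, A K t τ) / (∑ σ ∈ T K, A K t σ) ≤ wm K) ∧
      (∀ K t, |t| ≤ l₀ → (∑ τ ∈ Bad K t, B K t τ) / (∑ σ ∈ T K, B K t σ) ≤ wm K) ∧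
      Summable (fun K => Real.sqrt (wm K)) := by
  have hDA := slotDom_of_records (A := A) (Bad := Bad) Cell hV hΛ hcell Wd step E Bi hE hκ ρ hρ hρbar η hη hηbar hr1
    (jlogOf C) (jlogOf_le C) hdomA
  have hDB := slotDom_of_records (A := B) (Bad := Bad) Cell hV hΛ hcell Wd step E Bi hE hκ ρ hρ hρbar η hη hηbar hr1
    (jlogOf C) (jlogOf_le C) hdomB
  exact wildMassLetter_of_slotDom_twoRate_log (Cs := ρbar * Real.exp (-κ₁)) (mul_nonneg hρbar0 (Real.exp_pos _).le) hV
    hr0 hr1 hC hA hB hDA hDB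

end Records

/-! ## §6 The rate letter read in the memo's words: `2 < C·(κ₁ − η̄ − 4·log L)` [folklore] -/

section RateLetter

/-- With positional entropy `Λ = L⁴` per step of age and per-step survival `σ = e^{η̄ − κ₁}`: `−log(Λσ) = κ₁ − η̄ − 4·log L` — the memo's net rate
«`c − 4 log L`» (memo `c` = tree `κ₁ − η̄`). [folklore] -/
theorem neg_log_twoRate_eq {L : ℕ} (hL : 1 ≤ L) (κ₁ ηbar : ℝ) :
    -Real.log (((L : ℝ) ^ 4) * Real.exp (ηbar - κ₁)) = κ₁ - ηbar - 4 * Real.log L := by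
  have hL0 : (0 : ℝ) < L := by exact_mod_cast hL
  rw [Real.log_mul (pow_ne_zero _ hL0.ne') (Real.exp_ne_zero _), Real.log_pow, Real.log_exp]
  push_cast
  ring

/-- **★ THE EXPONENT-2 RATE CONDITION IN THE MEMO'S WORDS**: `2 < C·(−log(L⁴·e^{η̄−κ₁}))  ↔  2 < C·(κ₁ − η̄ − 4·log L)` — «`Σ_K √wild_K < ∞` iff
`κ₁(c − 4 log L) > 2`» with memo `κ₁` = `C`, memo `c` = `κ₁ − η̄` (compare exponent 1: `T4PersistentHistoryCount.twoRate_lt_one_of_margin`,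
`4·log L + η̄ < κ₁ ⇒ Λσ < 1`). [folklore] -/
theorem two_lt_mul_neg_log_twoRate_iff {L : ℕ} (hL : 1 ≤ L) {κ₁ ηbar C : ℝ} :
    2 < C * (-Real.log (((L : ℝ) ^ 4) * Real.exp (ηbar - κ₁))) ↔ 2 < C * (κ₁ - ηbar - 4 * Real.log L) := by
  rw [neg_log_twoRate_eq hL]

/-- Exponent 2 implies the rate condition of the kernel's existing (exponent-1) route: `2 < C·(κ₁ − η̄ − 4·log L)` with `0 < C` gives
`4·log L + η̄ < κ₁`, the hypothesis of `T4PersistentHistoryCount.twoRate_lt_one_of_margin` at `d = 4` (so `Λσ < 1`). [folklore] -/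
theorem margin_of_two_lt {L : ℕ} {κ₁ ηbar C : ℝ} (hC0 : 0 < C) (h : 2 < C * (κ₁ - ηbar - 4 * Real.log L)) :
    (4 : ℝ) * Real.log L + ηbar < κ₁ := by
  have h' : C * 0 < C * (κ₁ - ηbar - 4 * Real.log L) := by rw [mul_zero]; linarith
  have := lt_of_mul_lt_mul_left h' hC0.le
  linarith

end RateLetter

/-! ## §7 Sanity [folklore] -/

section Sanity

/-- Numerical sanity of the exponent-2 condition: with `r = ¼` (e.g. `L⁴σ = ¼`) the log-window constant `C = 2` already gives `2 < C·(−log r)`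
(`2·log 4 ≈ 2.77`). [folklore] -/
example : (2 : ℝ) < 2 * (-Real.log (1 / 4 : ℝ)) := by
  have h4 : (1 : ℝ) < Real.log 4 := by
    rw [Real.lt_log_iff_exp_lt (by norm_num : (0:ℝ) < 4)]
    have := Real.exp_one_lt_d9
    norm_num at this ⊢
    linarith
  have e : -Real.log (1 / 4 : ℝ) = Real.log 4 := by
    rw [one_div, Real.log_inv, neg_neg]
  rw [e]; linarith

/-- The division-form bridge is sharp on the trivial `RelWeightBound` (`Bad := ∅`, `W := 0`): the wild-mass block holds with `wm := 0` — recording, as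
the START-LIST §n20 FACTS say, that the weight face ALONE is junk-inhabited and carries content only jointly with the core-edge face. [folklore] -/
example {ι : Type*} (l₀ : ℝ) (T : ℕ → Finset ι) (A B : ℕ → ℝ → ι → ℝ)
    (hA : ∀ K t, |t| ≤ l₀ → ∀ τ ∈ T K, 0 ≤ A K t τ) (hB : ∀ K t, |t| ≤ l₀ → ∀ τ ∈ T K, 0 ≤ B K t τ) :
    ∃ wm : ℕ → ℝ, (∀ K, 0 ≤ wm K) ∧
      (∀ K t, |t| ≤ l₀ → (∑ τ ∈ (∅ : Finset ι), A K t τ) / (∑ σ ∈ T K, A K t σ) ≤ wm K) ∧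
      (∀ K t, |t| ≤ l₀ → (∑ τ ∈ (∅ : Finset ι), B K t τ) / (∑ σ ∈ T K, B K t σ) ≤ wm K) ∧
      Summable (fun K => Real.sqrt (wm K)) := by
  have hW : RelWeightBound l₀ T A B (fun _ _ => ∅) (fun _ => 0) :=
    { bad_subset := fun _ _ _ => Finset.empty_subset _
      nonneg := fun _ => le_rfl
      lt_one := fun _ => zero_lt_one
      summable := summable_zero
      bad_left := fun K t _ => by simp
      bad_right := fun K t _ => by simp }
  exact wildMassLetter_of_relWeightBound hW hA hB (by simp)

end Sanity

end Summit.QuantumFields.YangMills.BalabanUVNodes.N20WildMassLetterOfPersistentHistoryCount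

end
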